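import Mathlib
import HarnessLib

/-!
# Stub `stub_asymptoticsLog` of the line `Sketch` (log-window-tagged-tail) for the crux
`RelayRaceLocality.GibbsLightCone` (stmt-AtomisticToContinuum-12501)

Registered stub of the lead prover's skeleton (`Cruxes/GibbsLightCone/Lines/Sketch.lean`): the
genuine LOG-WINDOW bookkeeping of the union bound. For `t, θ, σ, c > 0` and any `C` there are a
constant `K > 0` and, for every `N`, a positive integer number of windows `n_N` and a window
length of `M_N` mean-free-time units `τ_N = (N+1)^{-1/3} / (σ² √θ)` with `n_N · M_N · τ_N = t`
exactly, such that eventually `1 ≤ M_N ≤ K log (N+2)` and `(N+1) · n_N · C e^{-c M_N} → 0`.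

Construction: `K = 6 / c`, `n_N = ⌈t / (K log(N+2) τ_N)⌉`, `M_N = t / (n_N τ_N)`. Then
`M_N ≤ K log(N+2)` for every `N`; since `K log(N+2) τ_N → 0` (a logarithm loses against the
power `(N+1)^{1/3}`), eventually `M_N > (K/2) log(N+2) = (3/c) log(N+2) ≥ 1`, whence
`e^{-c M_N} ≤ (N+2)^{-3}` while `n_N ≤ t/τ_N + 1 ≲ (N+1)^{1/3} ≤ N+2`, so the product is
`O(1/(N+2))`. Pure real analysis over Mathlib; no project declarations are used.
-/

namespace Summit.AtomisticToContinuum.HydrodynamicLimit.Theorems.LogWindowTaggedTail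

open MeasureTheory Filter Set

/-- A logarithm loses against a cube root along the shifted integers:
`log (N+2) · (N+1)^{-1/3} → 0` (from `log x = o(x^{1/3})` and `log (x+1) - log x → 0`).
[folklore] -/
theorem asymptoticsLog_tendsto_log_mul_rpow_neg_third :
    Tendsto (fun N : ℕ => Real.log ((N : ℝ) + 2) * ((N + 1 : ℕ) : ℝ) ^ (-(1 / 3 : ℝ)))
      atTop (nhds 0) := by
  -- real-variable version: `log (x+1) · x^{-1/3} → 0` as `x → ∞`
  have h1 : Tendsto (fun x : ℝ => Real.log x / x ^ (1 / 3 : ℝ)) atTop (nhds 0) :=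
    (isLittleO_log_rpow_atTop (by norm_num : (0 : ℝ) < 1 / 3)).tendsto_div_nhds_zero
  have h2 : Tendsto (fun x : ℝ => Real.log (x + 1) - Real.log x) atTop (nhds 0) :=
    Real.tendsto_log_comp_add_sub_log 1
  have h3 : Tendsto (fun x : ℝ => x ^ (-(1 / 3 : ℝ))) atTop (nhds 0) :=
    tendsto_rpow_neg_atTop (by norm_num : (0 : ℝ) < 1 / 3)
  have h4 : Tendsto (fun x : ℝ => Real.log x / x ^ (1 / 3 : ℝ) +
      (Real.log (x + 1) - Real.log x) * x ^ (-(1 / 3 : ℝ))) atTop (nhds 0) := by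
    have := h1.add (h2.mul h3)
    rw [mul_zero, add_zero] at this
    exact this
  have h5 : Tendsto (fun x : ℝ => Real.log (x + 1) * x ^ (-(1 / 3 : ℝ))) atTop (nhds 0) := by
    refine h4.congr' ?_
    filter_upwards [eventually_ge_atTop 0] with x hx
    rw [Real.rpow_neg hx, div_eq_mul_inv]
    ring
  have hcast : Tendsto (fun N : ℕ => ((N + 1 : ℕ) : ℝ)) atTop atTop :=
    tendsto_natCast_atTop_atTop.comp (tendsto_add_atTop_nat 1)
  refine (h5.comp hcast).congr fun N => ?_
  have hN : ((N + 1 : ℕ) : ℝ) + 1 = (N : ℝ) + 2 := by push_cast; ring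
  show Real.log (((N + 1 : ℕ) : ℝ) + 1) * ((N + 1 : ℕ) : ℝ) ^ (-(1 / 3 : ℝ)) = _
  rw [hN]

/-- LOG-WINDOW BOOKKEEPING (registered stub `stub_asymptoticsLog` of the line `Sketch` for the
crux `GibbsLightCone`, stmt-AtomisticToContinuum-12501; pure real analysis): for `t, θ, σ, c > 0`
and any `C` there are `K > 0` (namely `K = 6/c`) and, for every `N`, a positive integer `n_N` of
windows and a window length of `M_N` mean-free-time units `τ_N = (N+1)^{-1/3} / (σ² √θ)` with
`n_N · M_N · τ_N = t` exactly, such that eventually `1 ≤ M_N ≤ K log (N+2)` and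
`(N+1) · n_N · C e^{-c M_N} → 0`. Witness: `n_N = ⌈t / (K log(N+2) τ_N)⌉`,
`M_N = t / (n_N τ_N) ∈ ((3/c) log(N+2), (6/c) log(N+2)]` eventually, so that
`e^{-c M_N} ≤ (N+2)^{-3}` and `n_N = O(N+2)`. [folklore] -/
theorem stub_asymptoticsLog :
    ∀ (t θ σ c C : ℝ), 0 < t → 0 < θ → 0 < σ → 0 < c →
      ∃ (K : ℝ) (n : ℕ → ℕ) (M : ℕ → ℝ), 0 < K ∧
        (∀ N, 0 < n N) ∧
        (∀ N, (n N : ℝ) * (M N * (((N + 1 : ℕ) : ℝ) ^ (-(1 / 3 : ℝ)) / σ ^ 2 / Real.sqrt θ)) = t) ∧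
        (∀ᶠ N in atTop, 1 ≤ M N) ∧
        (∀ᶠ N in atTop, M N ≤ K * Real.log ((N : ℝ) + 2)) ∧
        Tendsto (fun N => ((N + 1 : ℕ) : ℝ) * (n N : ℝ) * (C * Real.exp (-c * M N))) atTop
          (nhds 0) := by
  intro t θ σ c C ht hθ hσ hc
  /- Notation: `a = σ² √θ`, `K = 6/c`, `x_N = N+1`, `r_N = x_N^{1/3}` (so `τ_N = (a r_N)⁻¹`),
  `L_N = log (N+2)`; the witnesses are `n_N = ⌈t a r_N / (K L_N)⌉` and `M_N = t a r_N / n_N`. -/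
  have hsq : 0 < Real.sqrt θ := Real.sqrt_pos.mpr hθ
  obtain ⟨a, ha_def⟩ : ∃ a : ℝ, a = σ ^ 2 * Real.sqrt θ := ⟨_, rfl⟩
  have ha : 0 < a := by rw [ha_def]; positivity
  obtain ⟨K, hK_def⟩ : ∃ K : ℝ, K = 6 / c := ⟨_, rfl⟩
  have hK : 0 < K := by rw [hK_def]; positivity
  have hcK : c * K = 6 := by rw [hK_def]; field_simp
  obtain ⟨x, hx⟩ : ∃ x : ℕ → ℝ, ∀ N, x N = ((N + 1 : ℕ) : ℝ) := ⟨_, fun _ => rfl⟩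
  obtain ⟨r, hr⟩ : ∃ r : ℕ → ℝ, ∀ N, r N = x N ^ (1 / 3 : ℝ) := ⟨_, fun _ => rfl⟩
  obtain ⟨L, hL⟩ : ∃ L : ℕ → ℝ, ∀ N, L N = Real.log ((N : ℝ) + 2) := ⟨_, fun _ => rfl⟩
  obtain ⟨n, hn⟩ : ∃ n : ℕ → ℕ, ∀ N, n N = ⌈t * a * r N / (K * L N)⌉₊ := ⟨_, fun _ => rfl⟩
  obtain ⟨M, hM⟩ : ∃ M : ℕ → ℝ, ∀ N, M N = t * a * r N / (n N : ℝ) := ⟨_, fun _ => rfl⟩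
  -- elementary facts about `x, r, L`
  have hx1 : ∀ N, 1 ≤ x N := fun N => by rw [hx]; exact_mod_cast Nat.le_add_left 1 N
  have hx0 : ∀ N, 0 < x N := fun N => lt_of_lt_of_le one_pos (hx1 N)
  have hy0 : ∀ N : ℕ, (0 : ℝ) < (N : ℝ) + 2 := fun N => by positivity
  have hy1 : ∀ N : ℕ, (1 : ℝ) ≤ (N : ℝ) + 2 := fun N => by
    have := (Nat.cast_nonneg N : (0 : ℝ) ≤ N); linarith
  have hxy : ∀ N, x N ≤ (N : ℝ) + 2 := fun N => by rw [hx]; push_cast; linarith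
  have hr0 : ∀ N, 0 < r N := fun N => by rw [hr]; exact Real.rpow_pos_of_pos (hx0 N) _
  have hrx : ∀ N, r N ≤ x N := fun N => by
    rw [hr]
    simpa using Real.rpow_le_rpow_of_exponent_le (hx1 N) (show (1 / 3 : ℝ) ≤ 1 by norm_num)
  have hL0 : ∀ N, 0 < L N := fun N => by
    rw [hL]
    have := (Nat.cast_nonneg N : (0 : ℝ) ≤ N)
    exact Real.log_pos (by linarith)
  have hg0 : ∀ N, 0 < K * L N := fun N => mul_pos hK (hL0 N)
  have hg2 : ∀ N, c / 3 ≤ L N → 2 ≤ K * L N := fun N h1 => by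
    have h5 : K * (c / 3) ≤ K * L N := mul_le_mul_of_nonneg_left h1 hK.le
    have h6 : K * (c / 3) = 2 := by
      rw [show K * (c / 3) = c * K / 3 by ring, hcK]; norm_num
    linarith
  -- elementary facts about the witnesses `n, M`
  have hq0 : ∀ N, 0 < t * a * r N / (K * L N) := fun N =>
    div_pos (mul_pos (mul_pos ht ha) (hr0 N)) (hg0 N)
  have hn0 : ∀ N, 0 < n N := fun N => by rw [hn]; exact Nat.ceil_pos.2 (hq0 N)
  have hn0' : ∀ N, (0 : ℝ) < n N := fun N => Nat.cast_pos.2 (hn0 N)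
  have hnge : ∀ N, t * a * r N / (K * L N) ≤ n N := fun N => by rw [hn]; exact Nat.le_ceil _
  have hnlt : ∀ N, (n N : ℝ) < t * a * r N / (K * L N) + 1 := fun N => by
    rw [hn]; exact Nat.ceil_lt_add_one (hq0 N).le
  -- upper bound `M_N ≤ K L_N`, for every `N`
  have hMle : ∀ N, M N ≤ K * L N := fun N => by
    have h1 := hn0' N
    have h2 := hg0 N
    rw [hM, div_le_iff₀ h1]
    have h3 := hnge N
    rw [div_le_iff₀ h2] at h3
    linarith
  -- lower bound `K L_N / 2 < M_N` as soon as `K L_N ≤ t a r_N`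
  have hMgt : ∀ N, K * L N ≤ t * a * r N → K * L N / 2 < M N := fun N hle => by
    have h1 := hn0' N
    have h2 := hg0 N
    rw [hM, lt_div_iff₀ h1]
    have h3 := hnlt N
    have h4 : (n N : ℝ) * (K * L N) < t * a * r N + K * L N := by
      have := mul_lt_mul_of_pos_right h3 h2
      rwa [add_mul, one_mul, div_mul_cancel₀ _ h2.ne'] at this
    linarith
  -- asymptotic inputs: `L_N → ∞` and `L_N / r_N → 0`
  have hLtop : Tendsto L atTop atTop := by
    have : Tendsto (fun N : ℕ => Real.log ((N : ℝ) + 2)) atTop atTop :=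
      Real.tendsto_log_atTop.comp
        (tendsto_atTop_add_const_right atTop (2 : ℝ) tendsto_natCast_atTop_atTop)
    exact this.congr fun N => (hL N).symm
  have hdecay : Tendsto (fun N => L N * (r N)⁻¹) atTop (nhds 0) := by
    refine asymptoticsLog_tendsto_log_mul_rpow_neg_third.congr fun N => ?_
    rw [hL, hr, hx, Real.rpow_neg (Nat.cast_nonneg _)]
  -- E1: eventually `c/3 ≤ L_N`; E2: eventually `K L_N ≤ t a r_N`
  have E1 : ∀ᶠ N in atTop, c / 3 ≤ L N := hLtop.eventually_ge_atTop _
  have E2 : ∀ᶠ N in atTop, K * L N ≤ t * a * r N := by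
    have hpos : (0 : ℝ) < t * a / K := div_pos (mul_pos ht ha) hK
    filter_upwards [(tendsto_order.1 hdecay).2 _ hpos] with N hN
    have h1 := hr0 N
    rw [← div_eq_mul_inv, div_lt_iff₀ h1] at hN
    have h2 : K * L N ≤ K * (t * a / K * r N) := mul_le_mul_of_nonneg_left hN.le hK.le
    have h3 : K * (t * a / K * r N) = t * a * r N := by field_simp
    linarith
  refine ⟨K, n, M, hK, hn0, fun N => ?_, ?_, Eventually.of_forall fun N => ?_, ?_⟩
  · -- the exact product `n_N · (M_N · τ_N) = t`
    have h1 := hn0' N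
    have h2 : (0 : ℝ) < ((N + 1 : ℕ) : ℝ) ^ (1 / 3 : ℝ) := by rw [← hx, ← hr]; exact hr0 N
    rw [hM, hr, hx, ha_def, Real.rpow_neg (Nat.cast_nonneg _)]
    field_simp
  · -- `1 ≤ M_N` eventually
    filter_upwards [E1, E2] with N h1 h2
    have h3 := hMgt N h2
    have h4 := hg2 N h1
    linarith
  · -- `M_N ≤ K log (N+2)` for every `N`
    have := hMle N
    rwa [hL] at this
  · -- `(N+1) · n_N · C e^{-c M_N} → 0`, dominated by `(t a + 1) |C| / (N+2)`
    have hlim : Tendsto (fun N : ℕ => (t * a + 1) * |C| / ((N : ℝ) + 2)) atTop (nhds 0) :=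
      tendsto_const_nhds.div_atTop
        (tendsto_atTop_add_const_right atTop (2 : ℝ) tendsto_natCast_atTop_atTop)
    refine squeeze_zero_norm' ?_ hlim
    filter_upwards [E1, E2] with N h1 h2
    have hxN := hx0 N
    have hrN := hr0 N
    have hnN := hn0' N
    have hyN := hy0 N
    have h3 := hMgt N h2
    have h4 := hg2 N h1
    -- `e^{-c M_N} ≤ (N+2)^{-3}`
    have hcM : 3 * L N ≤ c * M N := by
      have h5 := mul_lt_mul_of_pos_left h3 hc
      have h6 : c * (K * L N / 2) = 3 * L N := by
        rw [show c * (K * L N / 2) = c * K * L N / 2 by ring, hcK]; ring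
      linarith
    have hexp : Real.exp (-c * M N) ≤ (((N : ℝ) + 2) ^ 3)⁻¹ := by
      rw [← Real.exp_log (pow_pos hyN 3), ← Real.exp_neg, Real.exp_le_exp, Real.log_pow, ← hL]
      push_cast
      linarith
    -- `n_N ≤ (t a + 1) (N+2)`
    have hn_le : (n N : ℝ) ≤ (t * a + 1) * ((N : ℝ) + 2) := by
      have h5 := hnlt N
      have h6 : t * a * r N / (K * L N) ≤ t * a * r N := div_le_self (by positivity) (by linarith)
      have h7 : t * a * r N ≤ t * a * ((N : ℝ) + 2) :=
        mul_le_mul_of_nonneg_left ((hrx N).trans (hxy N)) (mul_pos ht ha).le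
      have h8 := hy1 N
      linarith
    have h9 := hxy N
    rw [← hx, Real.norm_eq_abs, abs_mul, abs_mul, abs_mul, abs_of_pos hxN, abs_of_pos hnN,
      abs_of_pos (Real.exp_pos _)]
    calc x N * (n N : ℝ) * (|C| * Real.exp (-c * M N))
        ≤ ((N : ℝ) + 2) * ((t * a + 1) * ((N : ℝ) + 2)) * (|C| * (((N : ℝ) + 2) ^ 3)⁻¹) := by
          gcongr
      _ = (t * a + 1) * |C| / ((N : ℝ) + 2) := by
          field_simp

end Summit.AtomisticToContinuum.HydrodynamicLimit.Theorems.LogWindowTaggedTail
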